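import Summits.Ventures.PercRepro.ProfileThreeAverageStep
import Summits.Ventures.PercRepro.ProfileThreeFat

/-!
# PercRepro — THE ROW `q = 3` OF (Π) ON EVERY SIMPLE MATROID WITHOUT THREE COLLINEAR POINTS
(p10, gen 6; `proofs/P10-Q3-NOSPLIT.md` addendum 4)

In a simple matroid in which every rank-2 set has at most two points (`LineFree`: no three collinear points, girth
`≥ 4`), every rank-3 set is an independent triple or a coloop-free set (a rank-3 set with `≥ 4` points and a coloop
`p` would leave a rank-2 set with `≥ 3` points), and the rank-`u` sets with exactly `u − 2` coloops do not exist
(their non-coloops would form a rank-2 set with `≥ 3` points).  So `INDEP₃⁺` (ProfileThreeAverageStep) pays the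
triples from the independent `u`-sets alone and Theorem B's injection (ProfileThreeFat, `aSets`) pays the
coloop-free sets from the rank-`u` sets with `u − 3` coloops and a coloop-free rank-3 core — two DISJOINT
subfamilies of the rank-`u` sets.  Hence `(Π_{3,u})` for every `u ≥ 4` (`profileIneq_three_of_lineFree`).  With
Theorem A (`ProfileThreeFourLine`: the row lifts over the points of `≥ 4`-point lines) the row `q = 3` on every finite
matroid reduces to the simple matroids having a 3-point line and no longer line.

* `LineFree`; `mem_coloops_of_indep`, `four_le_card_of_mem_fat3cf`, `coloops_eq_empty_of_lineFree`;
* `Rq_three_eq_union_of_lineFree`, `disjoint_indepSets_three_fat3cf`, `fSets_eq_empty_of_lineFree`;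
* `aSets_subset_levelSet`, `disjoint_indepSets_aSets`, `profileIneq_of_demand_le`, `profileIneq_of_rk_lt_level`;
* **`profileIneq_three_of_lineFree`**.
-/

open scoped Matroid

namespace PercRepro.Cogirth

open Finset ThmH Skew Shadow Profile

variable {α : Type} [DecidableEq α] {M : Matroid α} [M.Finite]

/-- **No three collinear points**: every rank-2 subset of the ground set has at most two elements. -/
def LineFree (M : Matroid α) [M.Finite] : Prop := ∀ L ⊆ gr M, rk M L = 2 → L.card ≤ 2

/-- `Σ demand ≤ C(u,q) · #levelSet` gives `(Π_{q,u})`. -/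
theorem profileIneq_of_demand_le (q u : ℕ) (hqu : q ≤ u) (hpos : 0 < u.choose q)
    (h : ∑ B ∈ Rq M q, demand M q u B ≤ u.choose q * (levelSet M u).card) : ProfileIneq M q u := by
  unfold ProfileIneq
  have hs : ∑ B ∈ Rq M q, (demand M q u B : ℚ) = (u.choose q : ℚ) * ∑ B ∈ Rq M q, price M q u B := by
    rw [mul_sum]
    apply sum_congr rfl
    intro B _
    rw [choose_mul_price_eq_demand q u hqu B]
  have hc : (0 : ℚ) < u.choose q := by exact_mod_cast hpos
  have h' : (∑ B ∈ Rq M q, (demand M q u B : ℚ)) ≤ (u.choose q : ℚ) * (levelSet M u).card := by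
    exact_mod_cast h
  rw [hs] at h'
  exact le_of_mul_le_mul_left h' hc

/-- `(Π_{q,u})` holds trivially when `ρ(E) < u`. -/
theorem profileIneq_of_rk_lt_level {q u : ℕ} (h : rk M (gr M) < u) : ProfileIneq M q u := by
  unfold ProfileIneq
  have hzero : ∀ B ∈ Rq M q, price M q u B = 0 := by
    intro B _
    unfold price
    rw [if_neg]
    intro hle
    have h1 : M.eRk ((gr M \ B : Finset α) : Set α) ≤ M.eRk (gr M : Set α) :=
      M.eRk_mono (by exact_mod_cast (sdiff_subset : gr M \ B ⊆ gr M))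
    have h2 := le_trans hle h1
    rw [← coe_rk] at h2
    have : u ≤ rk M (gr M) := by exact_mod_cast h2
    omega
  rw [sum_eq_zero hzero]
  exact_mod_cast Nat.zero_le _

/-- Every element of an independent set is a coloop of it. -/
theorem mem_coloops_of_indep {B : Finset α} (hi : M.Indep (B : Set α)) {e : α} (he : e ∈ B) :
    e ∈ coloops M B := by
  rw [mem_coloops]
  refine ⟨he, ?_⟩
  intro hcl
  have h1 : rk M B = B.card := rk_eq_card_of_indep hi
  have h2 : rk M (B.erase e) = (B.erase e).card :=
    rk_eq_card_of_indep (hi.subset (by exact_mod_cast erase_subset e B))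
  have h3 : rk M (insert e (B.erase e)) = rk M (B.erase e) := by
    rw [rk_insert_eq (mem_gr_of_indep (hi.subset (by simpa using he))) (by
      intro x hx
      exact mem_gr_of_indep (hi.subset (by simpa using (erase_subset e B hx)))), if_pos hcl]
  rw [insert_erase he, h1, h2, card_erase_of_mem he] at h3
  have : 0 < B.card := card_pos.2 ⟨e, he⟩
  omega

/-- A coloop-free rank-3 set has at least four elements. -/
theorem four_le_card_of_mem_fat3cf {B : Finset α} (hB : B ∈ fat3cf M) : 4 ≤ B.card := by
  rw [mem_fat3cf] at hB
  obtain ⟨hBR, hcol⟩ := hB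
  have hr : rk M B = 3 := by unfold rk; rw [(mem_Rq.1 hBR).2, ENat.toNat_coe]
  have hle : rk M B ≤ B.card := by
    unfold rk
    have := M.eRk_le_encard (B : Set α)
    rw [Set.encard_coe_eq_coe_finsetCard] at this
    exact ENat.toNat_le_of_le_coe this
  by_contra h
  have hc : B.card = 3 := by omega
  have hi : M.Indep (B : Set α) := indep_of_rk_eq_card (by rw [hr, hc])
  have hne : B.Nonempty := card_pos.1 (by omega)
  obtain ⟨e, he⟩ := hne
  have := mem_coloops_of_indep hi he
  rw [hcol] at this
  exact notMem_empty e this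

/-- In a line-free matroid a rank-3 set with `≥ 4` elements is coloop-free. -/
theorem coloops_eq_empty_of_lineFree (hl : LineFree M) {B : Finset α} (hB : B ∈ Rq M 3) (h4 : 4 ≤ B.card) :
    coloops M B = ∅ := by
  have hBg : B ⊆ gr M := (mem_Rq.1 hB).1
  have hr : rk M B = 3 := by unfold rk; rw [(mem_Rq.1 hB).2, ENat.toNat_coe]
  by_contra hne
  obtain ⟨e, he⟩ := nonempty_of_ne_empty hne
  have h1 := rk_erase_of_mem_coloops hBg he
  have heB : e ∈ B := (mem_coloops.1 he).1
  have h2 : rk M (B.erase e) = 2 := by omega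
  have h3 := hl (B.erase e) ((erase_subset e B).trans hBg) h2
  rw [card_erase_of_mem heB] at h3
  omega

/-- In a line-free matroid the rank-3 sets are the independent triples and the coloop-free sets. -/
theorem Rq_three_eq_union_of_lineFree (hl : LineFree M) : Rq M 3 = indepSets M 3 ∪ fat3cf M := by
  ext B
  rw [mem_union, mem_indepSets, mem_fat3cf]
  constructor
  · intro hB
    have hBg : B ⊆ gr M := (mem_Rq.1 hB).1
    have hr : rk M B = 3 := by unfold rk; rw [(mem_Rq.1 hB).2, ENat.toNat_coe]
    have hle : rk M B ≤ B.card := by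
      unfold rk
      have := M.eRk_le_encard (B : Set α)
      rw [Set.encard_coe_eq_coe_finsetCard] at this
      exact ENat.toNat_le_of_le_coe this
    rcases Nat.lt_or_ge B.card 4 with h | h
    · have hc : B.card = 3 := by omega
      exact Or.inl ⟨hBg, hc, indep_of_rk_eq_card (by rw [hr, hc])⟩
    · exact Or.inr ⟨hB, coloops_eq_empty_of_lineFree hl hB h⟩
  · rintro (⟨hBg, hc, hi⟩ | ⟨hB, _⟩)
    · rw [mem_Rq]
      refine ⟨hBg, ?_⟩
      rw [hi.eRk_eq_encard, Set.encard_coe_eq_coe_finsetCard, hc]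
    · exact hB

/-- The independent triples and the coloop-free rank-3 sets are disjoint. -/
theorem disjoint_indepSets_three_fat3cf : Disjoint (indepSets M 3) (fat3cf M) := by
  rw [disjoint_left]
  intro B h1 h2
  have := four_le_card_of_mem_fat3cf h2
  have := (mem_indepSets.1 h1).2.1
  omega

/-- In a line-free matroid there is no rank-`u` set with exactly `u − 2` coloops (`u ≥ 3`). -/
theorem fSets_eq_empty_of_lineFree (hl : LineFree M) {u : ℕ} (hu : 3 ≤ u) : fSets M u = ∅ := by
  rw [eq_empty_iff_forall_notMem]
  intro S hS
  rw [mem_fSets] at hS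
  obtain ⟨hSg, hr, hcard, hcol⟩ := hS
  have h1 := rk_sdiff_coloops_add_card hSg
  rw [hr, hcol] at h1
  have h2 : rk M (S \ coloops M S) = 2 := by omega
  have h3 := hl (S \ coloops M S) (sdiff_subset.trans hSg) h2
  rw [card_sdiff_of_subset (coloops_subset S), hcol] at h3
  omega

/-- `aSets` is a subfamily of the level set. -/
theorem aSets_subset_levelSet (u : ℕ) : aSets M u ⊆ levelSet M u := by
  intro S hS
  rw [mem_aSets] at hS
  rw [mem_levelSet]
  refine ⟨hS.1, ?_⟩
  rw [← coe_rk, hS.2.1]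

/-- The independent `u`-sets and `aSets` are disjoint (a member of `aSets` has `≥ u + 1` elements). -/
theorem disjoint_indepSets_aSets (u : ℕ) : Disjoint (indepSets M u) (aSets M u) := by
  rw [disjoint_left]
  intro S h1 h2
  have hc := (mem_indepSets.1 h1).2.1
  rw [mem_aSets] at h2
  obtain ⟨_, _, hcol, hcore⟩ := h2
  have h4 := four_le_card_of_mem_fat3cf hcore
  rw [card_sdiff_of_subset (coloops_subset S), hcol] at h4
  have := card_coloops_le_rk (M := M) (X := S)
  omega

omit [DecidableEq α] in
/-- The independent `u`-sets are a subfamily of the level set. -/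
theorem indepSets_subset_levelSet (u : ℕ) : indepSets M u ⊆ levelSet M u := by
  intro S hS
  rw [mem_indepSets] at hS
  rw [mem_levelSet]
  refine ⟨hS.1, ?_⟩
  rw [hS.2.2.eRk_eq_encard, Set.encard_coe_eq_coe_finsetCard, hS.2.1]

/-- **THE ROW `q = 3` ON EVERY SIMPLE MATROID WITHOUT THREE COLLINEAR POINTS** (`u ≥ 4`). -/
theorem profileIneq_three_of_lineFree (hs : Simple' M) (hl : LineFree M) {u : ℕ} (hu : 4 ≤ u) :
    ProfileIneq M 3 u := by
  rcases Nat.lt_or_ge (rk M (gr M)) u with hlt | huR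
  · exact profileIneq_of_rk_lt_level hlt
  have hpos : 0 < u.choose 3 := Nat.choose_pos (by omega)
  apply profileIneq_of_demand_le 3 u (by omega) hpos
  rw [Rq_three_eq_union_of_lineFree hl, sum_union disjoint_indepSets_three_fat3cf]
  have hI := indep3Plus_of_simple hs hu
  unfold Indep3Plus at hI
  rw [fSets_eq_empty_of_lineFree hl (by omega), card_empty, add_zero] at hI
  have hF := fat3cf_demand_le_choose_mul_card_aSets (M := M) (by omega : 3 ≤ u) huR
  have hcard : (indepSets M u).card + (aSets M u).card ≤ (levelSet M u).card := by
    rw [← card_union_of_disjoint (disjoint_indepSets_aSets u)]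
    exact card_le_card (union_subset (indepSets_subset_levelSet u) (aSets_subset_levelSet u))
  calc ∑ B ∈ indepSets M 3, demand M 3 u B + ∑ B ∈ fat3cf M, demand M 3 u B
      ≤ u.choose 3 * (indepSets M u).card + u.choose 3 * (aSets M u).card := Nat.add_le_add hI hF
    _ = u.choose 3 * ((indepSets M u).card + (aSets M u).card) := by ring
    _ ≤ u.choose 3 * (levelSet M u).card := Nat.mul_le_mul_left _ hcard

end PercRepro.Cogirth
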